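import Summits.QuantumFields.BalabanUV.Beta.FP.CompositeAveragingTablesInf
import Literature.MathematicalPhysics.QuantumFieldTheory.Balaban1983to89.Beta.AveragingHessianKernels

/-!
# `BalabanUV.Beta.FP.CompositeBorderTables` — road «FP» for binder row D1, RULING **R-FP-50 (a)** «THE (j,m)-FAMILIES OF RECORD ARE COMPOSITE IN ALL THREE TABLE
# SLOTS FOR m ≥ 2» (OWNER d1-p3 g16, journal l.35761; assignment «leaf-02 — GO on `FP/CompositeBorderTables(Letters)`»): THE m-FOLD COMPOSITE FIRST- AND SECOND-ORDER
# **BORDER TABLES** `VComp … m` (`V^{(m)}`), `V₂Comp … m` and the second-order slot of record `S₂Comp … m` — D1's chain-rule recursions `HComp` ∕ `M2Comp`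
# (`FP/CompositeAveragingTablesInf`) RUN ON THE UNPACKED ONE-STEP BORDER TENSORS and re-packed at blocking `Lc^m` by an1's packer `AveragingHessianKernels.packVH`,
# the `m = 1` members being the literal's one-step tables BY `rfl`

HONEST DEPENDENCY (page 1, mandatory): continuum YM on T⁴ ⇐ BetaPertH ∧ nine spine estimates (0/9 proved); BetaPertH ⇐ (D1) ∧ (D4) ∧ CAP+tail;
G-an2-4 gates asym, D1 and NE2/3/4.  HONEST FRAMING (cell contract, verbatim): «discharging `BetaPertH` makes Bałaban's UV stability UNCONDITIONAL —
a real constructive-QFT result; it is NOT the continuum limit and NOT the Clay problem.»  ABSOLUTE RULE (cell charter, verbatim): «No internally-minted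
statement may enter as a cited fact. Every hypothesis is either kernel-proved in this package or a verbatim quotation of a PUBLISHED theorem with page
reference. The manuscript(s) under audit are NOT citable for their own disputed steps — they are the thing under adjudication; programme-internal
(2001/route/tribunal) claims are never citable.»  THIS MODULE DEFINES OUR OBJECTS (candidates asserting nothing; «not in print») over EXISTING objects (D1's
recursions, an1's packer) and proves unfoldings, the `m = 1` pins, the `m = 2` value-check statements and block shapes.  0 `def … : Prop`, nothing cited, 0 sorry;
0 estimates; 0∕4 row-D1 binders; NOT the END re-base (leaf-06), NOT (J-S)(J-W), NOT SDF, NOT D1, NOT BetaPertH, NOT continuum, NOT Clay.  DEFINITION lane (reviewed).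

WHY (E-FP-16-1 ∕ R-FP-50, journal l.35679 ∕ l.35761; my located facts W-d1leaf02g15-4 l.35742).  The m-fold second-order table of record `WtInf m = W2SymOfK (G m) (Lc^m) S∞
(MCompInf m) S₂∞ (M2CompInf m)` (D2) carried the COMPOSITE multiplier ∕ mixed tables but the LEVEL-FREE fine stencils `S∞`, `S₂∞`, whose field–multiplier BORDER rows are the
ONE-STEP averaging-Hessian rows (`cVH•tabs.V`, `cB•tabs.vh₂S`, blocking `Lc`): inside the m-fold carrier (multiplier legs on the `Lc^m`-sites) this is a HYBRID word, not
the composite border `∂_U DQ^{(m)}`.  R-FP-50 (a) re-pins the families: the border rows of level `m` are the COMPOSITE ones.  LOCATED DESIGN (L-d1leaf02g15-2, INTENT 6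
l.35812) «NOTHING NEW TO RECURSE»: for `Q^{(m+2)} = Q^{(m+1)}↑ ∘ (λ·Q)` (one step at the BOTTOM, D1's convention) the first-order border tensor
`B^{(m)}(ρ,w; κ,u; α,x) := ∂_{U_{(κ,u)}} (DQ^{(m)})_{(ρ,w),(α,x)}` obeys
`B^{(m+2)}(ρw) = λ • Σ_{σv} aComp (m+1) (ρw; σv) · B(σv) + λ² • (DQ)ᵀ · B^{(m+1)}↑(ρw) · (DQ)` — LITERALLY `HComp_succ_succ` with the one-step Hessian family `H` REPLACED by
the one-step border tensor `B` — and the second-order border tensor `∂_U ∂_U DQ^{(m)}` obeys `M2Comp_succ_succ`'s four families with `(H, M₂, cΛ) ↦ (B, B₂, 1)`; this holds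
in EITHER chart of the (V-H) question (an2's ask (5) of R-FP-50): the chart decides the INPUT tensor (`rowsK Lc tabs.V = tabs.H` in the additive reading, `tabs.H +` a
first-derivative family in the product chart), NOT the recursion.  Hence the objects below are D1's `HComp`∕`M2Comp` BY NAME on the unpacked tensors, re-packed by an1's
`packVH` BY NAME, with the `m = 1` members pinned to the literal's tables by the «`if m = 1`» pattern of D2 §4 (`WtPin`).

SLOT CONVENTION (D1's, displayed): in an unpacked tensor `T ρ w : MKer`, the FIRST field slot `(u, inl κ)` is the BACKGROUND ∕ derivative bond, the SECOND `(x, inl α)` the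
FLUCTUATION bond — `hRow`'s `(H σ x′) u x (inl κ) (inl α)`; for symmetric one-step inputs (additive chart) the slot roles are immaterial; for a non-symmetric one-step border
tensor the recursion is the one DISPLAYED in `VComp_two` ∕ `V₂Comp_two` (an2 to confirm or locate the difference).  SCOPE (E-FP-16-2 ∕ Q-FP-16-6, journal l.35906 ∕ l.35916,
«GO modulo Q-FP-16-6»): these are the border jets of the AVERAGING rows `Q^{(m)}` ONLY; the full composite constraint of the sliced ∕ dressed system also has the NESTED SLICE
rows `τ_k · Q^{(k−1)}` (`k = 2, …, m`), whose border jets are `τ_k` (static) composed with `V^{(k−1)}` — NOT in this file (Q-FP-16-6: which typed object carries `τ_k`; a second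
`packK`-component is S-sized once it is named).

CONTENT (generic `d`; `N`, `Lc` blockings; `q` the one-step linearised weight, `λ` the inter-level conversion (D2 pins `lamPerfect = 1`)).
* §1 **`rowsK N V`** (the multiplier row `(ρ, w)` of a first-order border table `V κ u`, read at the multiplier leg `(inr ρ, N•w)`, as D1's `H`-shaped ff tensor),
  **`packK N T := packVH (…T…) N`** (the converse placement, an1's packer BY NAME: fm entry `[z ∈ N•ℤ]·T ρ (z∕N) u x (inl κ)(inl α)`, symmetric mf twin, ff = mm = 0),
  the second-order twins **`rowsK₂ N B`** (D1's `M₂ κ u σ v`-shape) and **`packK₂ ε N T₂`** (fm entry `[z ∈ N•ℤ]·T₂ κ u ρ (z∕N) u′ x (inl κ′)(inl α)`, mf entry `ε ·` the twin —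
  `ε = 1` an1's twin packing (`vhSAt`∕`vh₂SAt`), `ε = −1` an2's anti-twin `atw` (`SecondOrderSocketIdentification.vh₂SAn1`); the SIGN displayed, not decided here);
  entries, `rowsK_packK_inl_inl` (unpack ∘ pack = id on the ff block), **`packK_rowsK_packVH`** (pack ∘ unpack = id on packer-shaped tables), `off`∕`blk` plumbing (§0).
* §2 **`VComp Lc q λ V m := if m = 1 then V else packK (Lc^m) (HComp Lc q λ (rowsK Lc V) m)`** — `V^{(m)}`; `VComp_one` (`rfl`), `VComp_of_ne_one`, **`VComp_two`** (the m = 2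
  value-check statement: `packK (Lc^2) (ρ w ↦ λ • Σ_σ cwsum Lc (q ρ w σ) (rowsK Lc V σ) + λ² • liftF Lc q (rowsK Lc V ρ w))`), `VComp_eq_packK` (packer-shaped `V`: the `if` is
  immaterial), the ADDITIVE-CHART corollary `VComp_eq_packK_HComp` (`rowsK Lc V = H ⟹ VComp … m = packK (Lc^m) (HComp Lc q λ H m)`, `m ≠ 1` — R-FP-50 (a) «in the
  additive reading this tensor is D1's `HComp` re-indexed»), block shape (`_inl_inl`, `_inr_inr`, fm entry, support of the multiplier leg on `Lc^m•ℤ`), symmetry.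
* §3 **`V₂Comp ε Lc q λ V B m := if m = 1 then B else packK₂ ε (Lc^m) (M2Comp Lc q λ (rowsK Lc V) (rowsK₂ Lc B) 1 m)`** (D1's four families with `cΛ := 1` — D1's structural
  `cΛ` belongs to the MIXED table `M₂ = cΛ•∂Hess`, not to the border) and **`S₂Comp ε Lc q λ V B S₂inf cB m := if m = 1 then S₂inf else (S₂inf − cB 1 • B) + cB m • V₂Comp … m`** —
  the second-order slot of record RELATIVE to the m = 1 letter `S₂∞` (whose border part is `cB•tabs.vh₂S`: `PerfectBiStencilFixedPoint.limS₂_JsB12Sym_eq(_of_rows)`), the scalar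
  family `cB : ℕ → ℝ` DISPLAYED (typer pin; `cB 1` = the literal's `cB`); `V₂Comp_one`, `S₂Comp_one` (`rfl`), `V₂Comp_two`, `S₂Comp_of_ne_one`, block shape.
NOT HERE: the letters (FILE `CompositeBorderTablesLetters`); `SpureComp`∕`SLamComp`∕`SfoldComp`∕`WtComp` (next file); the slice-row component (Q-FP-16-6); the (V-H) chart
pin (an2∕an1); the scalars' values (typer); any identification with Bałaban's objects.
Provenance: D1 formalisation swarm LEAF PROVER 02, unit b2b-balaban-beta-d1-formalise-leaf-02 gen 15, 2026-08-21 (R-FP-50 (a); INTENT 6).  No existing file touched. -/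

noncomputable section

namespace Summit.QuantumFields.BalabanUV.Beta.FP.CompositeBorderTables

open Literature.MathematicalPhysics.QuantumFieldTheory.Balaban1983to89.Beta
open ExpKernelCalculus (MKer)
open AffineAveraging (Site toSite)
open AveragingContours (blk off toSite_zero blk_add_off)
open AveragingHessianKernels (Bond packVH packVH_inl_inr packVH_inr_inl packVH_inl_inl packVH_inr_inr packVH_symm off_add_smul blk_add_smul)
open OneStepResolventKernel (Fib)
open InterLevelTransport (cwsum)
open Summit.QuantumFields.BalabanUV.Beta.FP.CompositeAveragingTablesInf (aComp liftF liftFH HComp M2Comp aComp_one HComp_one HComp_two M2Comp_one M2Comp_two)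

variable {d : ℕ}

/-! ## §0 `off`∕`blk` plumbing on the sublattice `N•ℤ^{d+1}` -/

section Plumbing

/-- [folklore] A sublattice point has zero offset: `off N (N•w) = 0`. -/
theorem off_zsmul (N : ℕ) (w : Site (d + 1)) : off N ((N : ℤ) • w) = 0 := by
  have h := off_add_smul (d := d) N 0 w
  rw [zero_add] at h; rw [h]; funext i; simp [off]

/-- [folklore] … and block index `w`: `blk N (N•w) = w` (`1 ≤ N`). -/
theorem blk_zsmul {N : ℕ} (hN : 1 ≤ N) (w : Site (d + 1)) : blk N ((N : ℤ) • w) = w := by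
  have h := blk_add_smul (d := d) hN 0 w
  rw [zero_add] at h; rw [h]; funext i; simp [blk]

/-- [folklore] A point of zero offset IS the sublattice point of its block: `off N z = 0 ⟹ N • blk N z = z` (`1 ≤ N`). -/
theorem zsmul_blk_of_off_eq_zero {N : ℕ} (hN : 1 ≤ N) {z : Site (d + 1)} (hz : off N z = 0) : (N : ℤ) • blk N z = z := by
  have h := blk_add_off hN z
  have hz0 : (toSite (0 : Fin (d + 1) → ℕ) : Site (d + 1)) = 0 := toSite_zero
  rwa [hz, hz0, add_zero] at h

end Plumbing

/-! ## §1 Unpacking ∕ packing between border tables and D1's tensor families -/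

section Pack

variable (N : ℕ)

/-- [our object] **THE MULTIPLIER ROW OF A FIRST-ORDER BORDER TABLE, UNPACKED** to D1's `H`-shape: for the multiplier bond `(ρ, w)` (leg `inr ρ` at the sublattice site `N•w`),
the ff tensor `(u, inl κ; x, inl α) ↦ V κ u x (N•w) (inl α) (inr ρ)` — background bond `(κ, u)` FIRST, fluctuation bond `(α, x)` SECOND; every other block `0`. -/
def rowsK (V : Fin (d + 1) → Site (d + 1) → MKer (d + 1) (Fib d)) : Fin (d + 1) → Site (d + 1) → MKer (d + 1) (Fib d) :=
  fun ρ w u x a b =>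
    match a, b with
    | Sum.inl κ, Sum.inl α => V κ u x ((N : ℤ) • w) (Sum.inl α) (Sum.inr ρ)
    | Sum.inl _, Sum.inr _ => 0
    | Sum.inr _, Sum.inl _ => 0
    | Sum.inr _, Sum.inr _ => 0

/-- [our object] **A TENSOR FAMILY OF D1's `H`-SHAPE, PACKED** into a first-order border table at blocking `N` — an1's `packVH` BY NAME:
`packK N T κ u x z (inl α) (inr ρ) = [off N z = 0] · T ρ (blk N z) u x (inl κ) (inl α)`, the symmetric twin on `(inr ρ, inl α)`, ff = mm = `0`. -/
def packK (T : Fin (d + 1) → Site (d + 1) → MKer (d + 1) (Fib d)) : Fin (d + 1) → Site (d + 1) → MKer (d + 1) (Fib d) :=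
  fun κ u => packVH (fun ρ w f f' => T ρ w f'.2 f.2 (Sum.inl f'.1) (Sum.inl f.1)) N κ u

/-- [our object] **THE MULTIPLIER ROW OF A SECOND-ORDER BORDER TABLE, UNPACKED** to D1's `M₂ κ u σ v`-shape: outer derivative bond `(κ, u)`, multiplier bond `(ρ, w)`, then the
ff tensor `(u′, inl κ′; x, inl α) ↦ B κ u κ′ u′ x (N•w) (inl α) (inr ρ)`. -/
def rowsK₂ (B : Fin (d + 1) → Site (d + 1) → Fin (d + 1) → Site (d + 1) → MKer (d + 1) (Fib d)) :
    Fin (d + 1) → Site (d + 1) → Fin (d + 1) → Site (d + 1) → MKer (d + 1) (Fib d) :=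
  fun κ u ρ w u' x a b =>
    match a, b with
    | Sum.inl κ', Sum.inl α => B κ u κ' u' x ((N : ℤ) • w) (Sum.inl α) (Sum.inr ρ)
    | Sum.inl _, Sum.inr _ => 0
    | Sum.inr _, Sum.inl _ => 0
    | Sum.inr _, Sum.inr _ => 0

/-- [our object] **A TENSOR FAMILY OF D1's `M₂`-SHAPE, PACKED** into a second-order border table at blocking `N` with mf SIGN `ε`:
fm entry `[off N z = 0] · T₂ κ u ρ (blk N z) u′ x (inl κ′) (inl α)`, mf entry `ε ·` the twin, ff = mm = `0`
(`ε = 1`: an1's twin packing; `ε = −1`: an2's anti-twin `atw`). -/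
def packK₂ (ε : ℝ) (T₂ : Fin (d + 1) → Site (d + 1) → Fin (d + 1) → Site (d + 1) → MKer (d + 1) (Fib d)) :
    Fin (d + 1) → Site (d + 1) → Fin (d + 1) → Site (d + 1) → MKer (d + 1) (Fib d) :=
  fun κ u κ' u' x z a b =>
    match a, b with
    | Sum.inl α, Sum.inr ρ => if off N z = 0 then T₂ κ u ρ (blk N z) u' x (Sum.inl κ') (Sum.inl α) else 0
    | Sum.inr ρ, Sum.inl α => ε * (if off N x = 0 then T₂ κ u ρ (blk N x) u' z (Sum.inl κ') (Sum.inl α) else 0)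
    | Sum.inl _, Sum.inl _ => 0
    | Sum.inr _, Sum.inr _ => 0

variable (V : Fin (d + 1) → Site (d + 1) → MKer (d + 1) (Fib d)) (T : Fin (d + 1) → Site (d + 1) → MKer (d + 1) (Fib d))
  (B : Fin (d + 1) → Site (d + 1) → Fin (d + 1) → Site (d + 1) → MKer (d + 1) (Fib d))
  (T₂ : Fin (d + 1) → Site (d + 1) → Fin (d + 1) → Site (d + 1) → MKer (d + 1) (Fib d)) (ε : ℝ)

/-- [folklore] the ff entry of `rowsK`. -/
@[simp] theorem rowsK_inl_inl (ρ : Fin (d + 1)) (w u x : Site (d + 1)) (κ α : Fin (d + 1)) :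
    rowsK N V ρ w u x (Sum.inl κ) (Sum.inl α) = V κ u x ((N : ℤ) • w) (Sum.inl α) (Sum.inr ρ) := rfl

/-- [folklore] `rowsK` has no multiplier rows. -/
@[simp] theorem rowsK_inr (ρ : Fin (d + 1)) (w u x : Site (d + 1)) (ν : Fin (d + 1)) (b : Fib d) : rowsK N V ρ w u x (Sum.inr ν) b = 0 := by
  cases b <;> rfl

/-- [folklore] `rowsK` has no multiplier columns. -/
@[simp] theorem rowsK_inl_inr (ρ : Fin (d + 1)) (w u x : Site (d + 1)) (κ ν : Fin (d + 1)) : rowsK N V ρ w u x (Sum.inl κ) (Sum.inr ν) = 0 := rfl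
/-- [folklore] the fm entry of `packK`. -/
theorem packK_inl_inr (κ : Fin (d + 1)) (u x z : Site (d + 1)) (α ρ : Fin (d + 1)) :
    packK N T κ u x z (Sum.inl α) (Sum.inr ρ) = if off N z = 0 then T ρ (blk N z) u x (Sum.inl κ) (Sum.inl α) else 0 := rfl

/-- [folklore] the mf entry of `packK` (the symmetric twin). -/
theorem packK_inr_inl (κ : Fin (d + 1)) (u x z : Site (d + 1)) (ρ α : Fin (d + 1)) :
    packK N T κ u x z (Sum.inr ρ) (Sum.inl α) = if off N x = 0 then T ρ (blk N x) u z (Sum.inl κ) (Sum.inl α) else 0 := rfl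

/-- [folklore] `packK` has no ff block. -/
@[simp] theorem packK_inl_inl (κ : Fin (d + 1)) (u x z : Site (d + 1)) (α α' : Fin (d + 1)) : packK N T κ u x z (Sum.inl α) (Sum.inl α') = 0 := rfl
/-- [folklore] `packK` has no mm block. -/
@[simp] theorem packK_inr_inr (κ : Fin (d + 1)) (u x z : Site (d + 1)) (ρ ρ' : Fin (d + 1)) : packK N T κ u x z (Sum.inr ρ) (Sum.inr ρ') = 0 := rfl
/-- [folklore] `packK` is symmetric (an1's `packVH_symm`). -/
theorem packK_symm (κ : Fin (d + 1)) (u x z : Site (d + 1)) (a b : Fib d) : packK N T κ u x z a b = packK N T κ u z x b a :=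
  packVH_symm _ N κ u x z a b

/-- [folklore] the fm entry of `packK` AT a sublattice point: `packK N T κ u x (N•w) (inl α) (inr ρ) = T ρ w u x (inl κ) (inl α)` (`1 ≤ N`). -/
theorem packK_inl_inr_zsmul (hN : 1 ≤ N) (κ : Fin (d + 1)) (u x w : Site (d + 1)) (α ρ : Fin (d + 1)) :
    packK N T κ u x ((N : ℤ) • w) (Sum.inl α) (Sum.inr ρ) = T ρ w u x (Sum.inl κ) (Sum.inl α) := by
  rw [packK_inl_inr, if_pos (off_zsmul N w), blk_zsmul hN]

/-- [folklore] the fm entry of `packK` OFF the sublattice vanishes. -/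
theorem packK_inl_inr_of_off_ne_zero {N} {z : Site (d + 1)} (hz : off N z ≠ 0) (κ : Fin (d + 1)) (u x : Site (d + 1)) (α ρ : Fin (d + 1)) :
    packK N T κ u x z (Sum.inl α) (Sum.inr ρ) = 0 := by
  rw [packK_inl_inr, if_neg hz]

/-- [folklore] **UNPACK ∘ PACK = id ON THE ff BLOCK**: `rowsK N (packK N T) ρ w u x (inl κ) (inl α) = T ρ w u x (inl κ) (inl α)` (`1 ≤ N`; the other blocks of `rowsK` are `0`
by definition, those of `T` are not read). -/
theorem rowsK_packK_inl_inl (hN : 1 ≤ N) (ρ : Fin (d + 1)) (w u x : Site (d + 1)) (κ α : Fin (d + 1)) :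
    rowsK N (packK N T) ρ w u x (Sum.inl κ) (Sum.inl α) = T ρ w u x (Sum.inl κ) (Sum.inl α) := by
  rw [rowsK_inl_inl, packK_inl_inr_zsmul N T hN]

/-- [folklore] **PACK ∘ UNPACK = id ON PACKER-SHAPED TABLES**: for a table that IS an1's packing of some 3-tensor `K`, `packK N (rowsK N (packVH K N ·)) = packVH K N ·` (`1 ≤ N`). -/
theorem packK_rowsK_packVH (hN : 1 ≤ N) (K : Fin (d + 1) → Site (d + 1) → Bond (d + 1) → Bond (d + 1) → ℝ) :
    packK N (rowsK N (fun κ u => packVH K N κ u)) = fun κ u => packVH K N κ u := by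
  funext κ u x z a b
  rcases a with α | ρ <;> rcases b with α' | ρ'
  · rfl
  · rw [packK_inl_inr, packVH_inl_inr]
    by_cases hz : off N z = 0
    · rw [if_pos hz, if_pos hz, rowsK_inl_inl, packVH_inl_inr, if_pos (off_zsmul N _), blk_zsmul hN]
    · rw [if_neg hz, if_neg hz]
  · rw [packK_inr_inl, packVH_inr_inl]
    by_cases hx : off N x = 0
    · rw [if_pos hx, if_pos hx, rowsK_inl_inl, packVH_inl_inr, if_pos (off_zsmul N _), blk_zsmul hN]
    · rw [if_neg hx, if_neg hx]
  · rfl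

/-- [folklore] the ff entry of `rowsK₂`. -/
@[simp] theorem rowsK₂_inl_inl (κ : Fin (d + 1)) (u : Site (d + 1)) (ρ : Fin (d + 1)) (w u' x : Site (d + 1)) (κ' α : Fin (d + 1)) :
    rowsK₂ N B κ u ρ w u' x (Sum.inl κ') (Sum.inl α) = B κ u κ' u' x ((N : ℤ) • w) (Sum.inl α) (Sum.inr ρ) := rfl

/-- [folklore] `rowsK₂` has no multiplier rows. -/
@[simp] theorem rowsK₂_inr (κ : Fin (d + 1)) (u : Site (d + 1)) (ρ : Fin (d + 1)) (w u' x : Site (d + 1)) (ν : Fin (d + 1)) (b : Fib d) :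
    rowsK₂ N B κ u ρ w u' x (Sum.inr ν) b = 0 := by
  cases b <;> rfl

/-- [folklore] `rowsK₂` has no multiplier columns. -/
@[simp] theorem rowsK₂_inl_inr (κ : Fin (d + 1)) (u : Site (d + 1)) (ρ : Fin (d + 1)) (w u' x : Site (d + 1)) (κ' ν : Fin (d + 1)) :
    rowsK₂ N B κ u ρ w u' x (Sum.inl κ') (Sum.inr ν) = 0 := rfl

/-- [folklore] the fm entry of `packK₂`. -/
theorem packK₂_inl_inr (κ : Fin (d + 1)) (u : Site (d + 1)) (κ' : Fin (d + 1)) (u' x z : Site (d + 1)) (α ρ : Fin (d + 1)) :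
    packK₂ N ε T₂ κ u κ' u' x z (Sum.inl α) (Sum.inr ρ) = if off N z = 0 then T₂ κ u ρ (blk N z) u' x (Sum.inl κ') (Sum.inl α) else 0 := rfl

/-- [folklore] the mf entry of `packK₂` (`ε ·` the twin). -/
theorem packK₂_inr_inl (κ : Fin (d + 1)) (u : Site (d + 1)) (κ' : Fin (d + 1)) (u' x z : Site (d + 1)) (ρ α : Fin (d + 1)) :
    packK₂ N ε T₂ κ u κ' u' x z (Sum.inr ρ) (Sum.inl α) = ε * (if off N x = 0 then T₂ κ u ρ (blk N x) u' z (Sum.inl κ') (Sum.inl α) else 0) := rfl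

/-- [folklore] `packK₂` has no ff block. -/
@[simp] theorem packK₂_inl_inl (κ : Fin (d + 1)) (u : Site (d + 1)) (κ' : Fin (d + 1)) (u' x z : Site (d + 1)) (α α' : Fin (d + 1)) :
    packK₂ N ε T₂ κ u κ' u' x z (Sum.inl α) (Sum.inl α') = 0 := rfl

/-- [folklore] `packK₂` has no mm block. -/
@[simp] theorem packK₂_inr_inr (κ : Fin (d + 1)) (u : Site (d + 1)) (κ' : Fin (d + 1)) (u' x z : Site (d + 1)) (ρ ρ' : Fin (d + 1)) :
    packK₂ N ε T₂ κ u κ' u' x z (Sum.inr ρ) (Sum.inr ρ') = 0 := rfl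

/-- [folklore] the twin law of `packK₂`: mf entry = `ε ·` the transposed fm entry. -/
theorem packK₂_twin (κ : Fin (d + 1)) (u : Site (d + 1)) (κ' : Fin (d + 1)) (u' x z : Site (d + 1)) (ρ α : Fin (d + 1)) :
    packK₂ N ε T₂ κ u κ' u' z x (Sum.inr ρ) (Sum.inl α) = ε * packK₂ N ε T₂ κ u κ' u' x z (Sum.inl α) (Sum.inr ρ) := rfl

/-- [folklore] the fm entry of `packK₂` AT a sublattice point (`1 ≤ N`). -/
theorem packK₂_inl_inr_zsmul (hN : 1 ≤ N) (κ : Fin (d + 1)) (u : Site (d + 1)) (κ' : Fin (d + 1)) (u' x w : Site (d + 1)) (α ρ : Fin (d + 1)) :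
    packK₂ N ε T₂ κ u κ' u' x ((N : ℤ) • w) (Sum.inl α) (Sum.inr ρ) = T₂ κ u ρ w u' x (Sum.inl κ') (Sum.inl α) := by
  rw [packK₂_inl_inr, if_pos (off_zsmul N w), blk_zsmul hN]

/-- [folklore] **UNPACK ∘ PACK = id ON THE ff BLOCK** (second order; `1 ≤ N`). -/
theorem rowsK₂_packK₂_inl_inl (hN : 1 ≤ N) (κ : Fin (d + 1)) (u : Site (d + 1)) (ρ : Fin (d + 1)) (w u' x : Site (d + 1)) (κ' α : Fin (d + 1)) :
    rowsK₂ N (packK₂ N ε T₂) κ u ρ w u' x (Sum.inl κ') (Sum.inl α) = T₂ κ u ρ w u' x (Sum.inl κ') (Sum.inl α) := by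
  rw [rowsK₂_inl_inl, packK₂_inl_inr_zsmul N T₂ ε hN]

end Pack

/-! ## §2 The m-fold composite FIRST-ORDER border table `V^{(m)}` -/

section First

variable (Lc : ℕ) (q : Fin (d + 1) → Site (d + 1) → Fin (d + 1) → Site (d + 1) → ℝ) (lam : ℝ) (V : Fin (d + 1) → Site (d + 1) → MKer (d + 1) (Fib d))

/-- [our object — a CANDIDATE asserting nothing] **THE m-FOLD COMPOSITE FIRST-ORDER BORDER TABLE** `V^{(m)}` (R-FP-50 (a)): the one-step table `V` at `m = 1` (the literal:
`tabs.V`), and for `m ≠ 1` D1's second-order chain-rule recursion `HComp` RUN ON THE UNPACKED ONE-STEP BORDER TENSOR `rowsK Lc V`, re-packed at blocking `Lc^m`. -/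
def VComp (m : ℕ) : Fin (d + 1) → Site (d + 1) → MKer (d + 1) (Fib d) :=
  if m = 1 then V else packK (Lc ^ m) (HComp Lc q lam (rowsK Lc V) m)

/-- [folklore] **THE m = 1 PIN**: `VComp … 1 = V` — the literal's one-step border table, by `rfl`. -/
theorem VComp_one : VComp Lc q lam V 1 = V := if_pos rfl

/-- [folklore] Off `m = 1` the table is the packed composite tensor. -/
theorem VComp_of_ne_one {m : ℕ} (hm : m ≠ 1) : VComp Lc q lam V m = packK (Lc ^ m) (HComp Lc q lam (rowsK Lc V) m) := if_neg hm

/-- [folklore] **THE TWO-FOLD BORDER TABLE SPELLED OUT** (the m = 2 value-check statement; `HComp_two`):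
`VComp … 2 = packK (Lc^2) (ρ w ↦ λ • Σ_σ cwsum Lc (q ρ w σ) (rowsK Lc V σ) + λ² • liftF Lc q (rowsK Lc V ρ w))` — the one-step border rows transported by the one-step weights
PLUS the one-step border tensor of the upper step pulled back through the weights on both field slots. -/
theorem VComp_two : VComp Lc q lam V 2
    = packK (Lc ^ 2) (fun ρ w => lam • (∑ σ : Fin (d + 1), cwsum Lc (q ρ w σ) (rowsK Lc V σ)) + (lam ^ 2) • liftF Lc q (rowsK Lc V ρ w)) := by
  have h : HComp Lc q lam (rowsK Lc V) 2
      = fun ρ w => lam • (∑ σ : Fin (d + 1), cwsum Lc (q ρ w σ) (rowsK Lc V σ)) + (lam ^ 2) • liftF Lc q (rowsK Lc V ρ w) :=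
    funext fun ρ => funext fun w => HComp_two Lc q lam (rowsK Lc V) ρ w
  rw [VComp_of_ne_one Lc q lam V (by decide), h]

/-- [folklore] **PACKER-SHAPED ONE-STEP TABLES: THE `if` IS IMMATERIAL** — if `V = packK Lc (rowsK Lc V)` (e.g. `V = packVH K Lc ·`, `packK_rowsK_packVH`), then for EVERY `m`
`VComp … m = packK (Lc^m) (HComp Lc q λ (rowsK Lc V) m)` (`m = 0`: both sides are the empty table's packing). -/
theorem VComp_eq_packK (hV : V = packK Lc (rowsK Lc V)) (m : ℕ) : VComp Lc q lam V m = packK (Lc ^ m) (HComp Lc q lam (rowsK Lc V) m) := by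
  by_cases h1 : m = 1
  · subst h1
    rw [VComp_one, pow_one, HComp_one]
    exact hV
  · exact VComp_of_ne_one Lc q lam V h1

/-- [folklore] **THE ADDITIVE-CHART COROLLARY** (R-FP-50 (a)): if the unpacked one-step border tensor IS the Hessian family `H`, `VComp … m = packK (Lc^m) (HComp Lc q λ H m)` (`m ≠ 1`). -/
theorem VComp_eq_packK_HComp {H : Fin (d + 1) → Site (d + 1) → MKer (d + 1) (Fib d)} (hVH : rowsK Lc V = H) {m : ℕ} (hm : m ≠ 1) :
    VComp Lc q lam V m = packK (Lc ^ m) (HComp Lc q lam H m) := by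
  rw [VComp_of_ne_one Lc q lam V hm, hVH]

/-- [folklore] Block shape off `m = 1`: no ff block. -/
theorem VComp_inl_inl {m : ℕ} (hm : m ≠ 1) (κ : Fin (d + 1)) (u x z : Site (d + 1)) (α α' : Fin (d + 1)) :
    VComp Lc q lam V m κ u x z (Sum.inl α) (Sum.inl α') = 0 := by
  rw [VComp_of_ne_one Lc q lam V hm]; rfl

/-- [folklore] Block shape off `m = 1`: no mm block. -/
theorem VComp_inr_inr {m : ℕ} (hm : m ≠ 1) (κ : Fin (d + 1)) (u x z : Site (d + 1)) (ρ ρ' : Fin (d + 1)) :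
    VComp Lc q lam V m κ u x z (Sum.inr ρ) (Sum.inr ρ') = 0 := by
  rw [VComp_of_ne_one Lc q lam V hm]; rfl

/-- [folklore] Symmetry off `m = 1` (an1's `packVH_symm`). -/
theorem VComp_symm {m : ℕ} (hm : m ≠ 1) (κ : Fin (d + 1)) (u x z : Site (d + 1)) (a b : Fib d) :
    VComp Lc q lam V m κ u x z a b = VComp Lc q lam V m κ u z x b a := by
  rw [VComp_of_ne_one Lc q lam V hm]; exact packK_symm _ _ κ u x z a b

/-- [folklore] **THE fm ENTRY AT A LEVEL-`m` MULTIPLIER SITE** (`m ≠ 1`, `1 ≤ Lc^m`): `VComp … m κ u x (Lc^m•w) (inl α) (inr ρ) = HComp Lc q λ (rowsK Lc V) m ρ w u x (inl κ) (inl α)`. -/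
theorem VComp_inl_inr_zsmul {m : ℕ} (hm : m ≠ 1) (hN : 1 ≤ Lc ^ m) (κ : Fin (d + 1)) (u x w : Site (d + 1)) (α ρ : Fin (d + 1)) :
    VComp Lc q lam V m κ u x (((Lc ^ m : ℕ) : ℤ) • w) (Sum.inl α) (Sum.inr ρ) = HComp Lc q lam (rowsK Lc V) m ρ w u x (Sum.inl κ) (Sum.inl α) := by
  rw [VComp_of_ne_one Lc q lam V hm, packK_inl_inr_zsmul _ _ hN]

/-- [folklore] **SUPPORT OF THE MULTIPLIER LEG** (`m ≠ 1`): off `Lc^m•ℤ^{d+1}` the fm entry vanishes. -/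
theorem VComp_inl_inr_of_off_ne_zero {m : ℕ} (hm : m ≠ 1) {z : Site (d + 1)} (hz : off (Lc ^ m) z ≠ 0) (κ : Fin (d + 1)) (u x : Site (d + 1)) (α ρ : Fin (d + 1)) :
    VComp Lc q lam V m κ u x z (Sum.inl α) (Sum.inr ρ) = 0 := by
  rw [VComp_of_ne_one Lc q lam V hm, packK_inl_inr_of_off_ne_zero _ hz]

end First

/-! ## §3 The m-fold composite SECOND-ORDER border table and the second-order slot of record -/

section Second

variable (ε : ℝ) (Lc : ℕ) (q : Fin (d + 1) → Site (d + 1) → Fin (d + 1) → Site (d + 1) → ℝ) (lam : ℝ)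
  (V : Fin (d + 1) → Site (d + 1) → MKer (d + 1) (Fib d)) (B : Fin (d + 1) → Site (d + 1) → Fin (d + 1) → Site (d + 1) → MKer (d + 1) (Fib d))

/-- [our object — a CANDIDATE asserting nothing] **THE m-FOLD COMPOSITE SECOND-ORDER BORDER TABLE**: the one-step table `B` at `m = 1` (the literal: `tabs.vh₂S`), and for `m ≠ 1`
D1's third-order chain-rule recursion `M2Comp` (four families) RUN ON THE UNPACKED BORDER TENSORS `(rowsK Lc V, rowsK₂ Lc B)` with `cΛ := 1`, re-packed at blocking `Lc^m` with
mf sign `ε`. -/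
def V₂Comp (m : ℕ) : Fin (d + 1) → Site (d + 1) → Fin (d + 1) → Site (d + 1) → MKer (d + 1) (Fib d) :=
  if m = 1 then B else packK₂ (Lc ^ m) ε (M2Comp Lc q lam (rowsK Lc V) (rowsK₂ Lc B) 1 m)

/-- [folklore] **THE m = 1 PIN**: `V₂Comp … 1 = B` (`rfl`). -/
theorem V₂Comp_one : V₂Comp ε Lc q lam V B 1 = B := if_pos rfl

/-- [folklore] Off `m = 1` the table is the packed composite tensor. -/
theorem V₂Comp_of_ne_one {m : ℕ} (hm : m ≠ 1) :
    V₂Comp ε Lc q lam V B m = packK₂ (Lc ^ m) ε (M2Comp Lc q lam (rowsK Lc V) (rowsK₂ Lc B) 1 m) := if_neg hm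

/-- [folklore] **THE TWO-FOLD SECOND-ORDER BORDER TABLE SPELLED OUT** (the m = 2 value-check statement; `M2Comp_two` with `(H, M₂, cΛ) := (rowsK Lc V, rowsK₂ Lc B, 1)`). -/
theorem V₂Comp_two : V₂Comp ε Lc q lam V B 2
    = packK₂ (Lc ^ 2) ε (fun κ u ρ w =>
        lam • (∑ σ : Fin (d + 1), cwsum Lc (q ρ w σ) (rowsK₂ Lc B κ u σ))
        + (lam ^ 2 * 1) • ((∑ σ : Fin (d + 1), cwsum Lc
              (fun v => ∑ σ' : Fin (d + 1), ∑' v' : Site (d + 1), rowsK Lc V ρ w v v' (Sum.inl σ) (Sum.inl σ') * q σ' v' κ u) (rowsK Lc V σ))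
            + liftFH Lc q (rowsK Lc V) κ u (rowsK Lc V ρ w))
        + (lam ^ 3) • (∑ σ' : Fin (d + 1), cwsum Lc (fun v' => q σ' v' κ u) (fun v' => liftF Lc q (rowsK₂ Lc B σ' v' ρ w)))) := by
  have h : M2Comp Lc q lam (rowsK Lc V) (rowsK₂ Lc B) 1 2 = (fun κ u ρ w =>
        lam • (∑ σ : Fin (d + 1), cwsum Lc (q ρ w σ) (rowsK₂ Lc B κ u σ))
        + (lam ^ 2 * 1) • ((∑ σ : Fin (d + 1), cwsum Lc
              (fun v => ∑ σ' : Fin (d + 1), ∑' v' : Site (d + 1), rowsK Lc V ρ w v v' (Sum.inl σ) (Sum.inl σ') * q σ' v' κ u) (rowsK Lc V σ))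
            + liftFH Lc q (rowsK Lc V) κ u (rowsK Lc V ρ w))
        + (lam ^ 3) • (∑ σ' : Fin (d + 1), cwsum Lc (fun v' => q σ' v' κ u) (fun v' => liftF Lc q (rowsK₂ Lc B σ' v' ρ w)))) :=
    funext fun κ => funext fun u => funext fun ρ => funext fun w => M2Comp_two Lc q lam (rowsK Lc V) (rowsK₂ Lc B) 1 κ u ρ w
  rw [V₂Comp_of_ne_one ε Lc q lam V B (by decide), h]

/-- [folklore] Block shape off `m = 1`: no ff block. -/
theorem V₂Comp_inl_inl {m : ℕ} (hm : m ≠ 1) (κ : Fin (d + 1)) (u : Site (d + 1)) (κ' : Fin (d + 1)) (u' x z : Site (d + 1)) (α α' : Fin (d + 1)) :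
    V₂Comp ε Lc q lam V B m κ u κ' u' x z (Sum.inl α) (Sum.inl α') = 0 := by
  rw [V₂Comp_of_ne_one ε Lc q lam V B hm]; rfl

/-- [folklore] Block shape off `m = 1`: no mm block. -/
theorem V₂Comp_inr_inr {m : ℕ} (hm : m ≠ 1) (κ : Fin (d + 1)) (u : Site (d + 1)) (κ' : Fin (d + 1)) (u' x z : Site (d + 1)) (ρ ρ' : Fin (d + 1)) :
    V₂Comp ε Lc q lam V B m κ u κ' u' x z (Sum.inr ρ) (Sum.inr ρ') = 0 := by
  rw [V₂Comp_of_ne_one ε Lc q lam V B hm]; rfl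

/-- [folklore] The twin law off `m = 1`: mf entry = `ε ·` the transposed fm entry. -/
theorem V₂Comp_twin {m : ℕ} (hm : m ≠ 1) (κ : Fin (d + 1)) (u : Site (d + 1)) (κ' : Fin (d + 1)) (u' x z : Site (d + 1)) (ρ α : Fin (d + 1)) :
    V₂Comp ε Lc q lam V B m κ u κ' u' z x (Sum.inr ρ) (Sum.inl α) = ε * V₂Comp ε Lc q lam V B m κ u κ' u' x z (Sum.inl α) (Sum.inr ρ) := by
  rw [V₂Comp_of_ne_one ε Lc q lam V B hm]; rfl

/-- [folklore] **THE fm ENTRY AT A LEVEL-`m` MULTIPLIER SITE** (`m ≠ 1`, `1 ≤ Lc^m`). -/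
theorem V₂Comp_inl_inr_zsmul {m : ℕ} (hm : m ≠ 1) (hN : 1 ≤ Lc ^ m) (κ : Fin (d + 1)) (u : Site (d + 1)) (κ' : Fin (d + 1)) (u' x w : Site (d + 1))
    (α ρ : Fin (d + 1)) :
    V₂Comp ε Lc q lam V B m κ u κ' u' x (((Lc ^ m : ℕ) : ℤ) • w) (Sum.inl α) (Sum.inr ρ)
      = M2Comp Lc q lam (rowsK Lc V) (rowsK₂ Lc B) 1 m κ u ρ w u' x (Sum.inl κ') (Sum.inl α) := by
  rw [V₂Comp_of_ne_one ε Lc q lam V B hm, packK₂_inl_inr_zsmul _ _ _ hN]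

variable (S₂inf : Fin (d + 1) → Site (d + 1) → Fin (d + 1) → Site (d + 1) → MKer (d + 1) (Fib d)) (cB : ℕ → ℝ)

/-- [our object — a CANDIDATE asserting nothing] **THE SECOND-ORDER STENCIL SLOT OF RECORD AT LEVEL `m`** (R-FP-50 (a) `S₂Comp`), RELATIVE to the m = 1 LETTER `S₂∞`: at `m = 1`
the letter itself; for `m ≠ 1` its border part `cB 1 • B` (the literal: `cB • tabs.vh₂S`, `PerfectBiStencilFixedPoint.limS₂_JsB12Sym_eq_of_rows`) REPLACED by the composite one
`cB m • V₂Comp … m` — the ff (quartic) part being level-free.  The scalar family `cB` is DISPLAYED (typer pin). -/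
def S₂Comp (m : ℕ) : Fin (d + 1) → Site (d + 1) → Fin (d + 1) → Site (d + 1) → MKer (d + 1) (Fib d) :=
  if m = 1 then S₂inf else fun κ u κ' u' => (S₂inf κ u κ' u' - cB 1 • B κ u κ' u') + cB m • V₂Comp ε Lc q lam V B m κ u κ' u'

/-- [folklore] **THE m = 1 PIN**: `S₂Comp … 1 = S₂∞` (`rfl`). -/
theorem S₂Comp_one : S₂Comp ε Lc q lam V B S₂inf cB 1 = S₂inf := if_pos rfl

/-- [folklore] Off `m = 1`: the letter with its one-step border part replaced by the composite one. -/
theorem S₂Comp_of_ne_one {m : ℕ} (hm : m ≠ 1) :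
    S₂Comp ε Lc q lam V B S₂inf cB m = fun κ u κ' u' => (S₂inf κ u κ' u' - cB 1 • B κ u κ' u') + cB m • V₂Comp ε Lc q lam V B m κ u κ' u' := if_neg hm

/-- [folklore] **THE ff BLOCK IS LEVEL-FREE** (`m ≠ 1`; one-step border table without ff block): on `(inl, inl)` entries `S₂Comp … m = S₂∞`. -/
theorem S₂Comp_inl_inl {m : ℕ} (hm : m ≠ 1) (hB : ∀ κ u κ' u' x z (α α' : Fin (d + 1)), B κ u κ' u' x z (Sum.inl α) (Sum.inl α') = 0)
    (κ : Fin (d + 1)) (u : Site (d + 1)) (κ' : Fin (d + 1)) (u' x z : Site (d + 1)) (α α' : Fin (d + 1)) :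
    S₂Comp ε Lc q lam V B S₂inf cB m κ u κ' u' x z (Sum.inl α) (Sum.inl α') = S₂inf κ u κ' u' x z (Sum.inl α) (Sum.inl α') := by
  rw [S₂Comp_of_ne_one ε Lc q lam V B S₂inf cB hm]
  simp only [Pi.add_apply, Pi.sub_apply, Pi.smul_apply, smul_eq_mul, hB, V₂Comp_inl_inl ε Lc q lam V B hm, mul_zero, sub_zero, add_zero]

end Second

end Summit.QuantumFields.BalabanUV.Beta.FP.CompositeBorderTables

end
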